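import Summits.BirchSwinnertonDyer.BirchSwinnertonDyer.Theorems.PrintCf2SplitBadTwoRestrictedSelmerFiniteOfShaCore
import Summits.BirchSwinnertonDyer.BirchSwinnertonDyer.Theorems.PrintCf2SplitBadTwoLevelProjTorsionClasses
import Summits.BirchSwinnertonDyer.BirchSwinnertonDyer.Theorems.PrintCf2SplitBadTwoF1Holds
import Summits.BirchSwinnertonDyer.BirchSwinnertonDyer.Theorems.PrintCf2SplitBadTwoCMShaBottomValueOfSel
import HarnessLib

/-!
# Crux `PrintCf2.SplitBadTwoRankOneOfFacts` (stmt-BirchSwinnertonDyer-20368), road α v10.4/10.5, (BF) «`Ш` finite ⟹ `𝔖_{v̄}(K, W*)` finite»,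
# part 3: ON EVERY S3c FRAME, `Finite Ш(W_K/K)[2^∞]` AND (MW-v̄) ⟹ `Finite 𝔖_{v̄}(K, W*)`

Cell `bsd-print-cf2`, EXTRA WIDTH seat `bsd-line-cf2-p1-w4` g10 (prover-bsd-line-cf2-p1-w4-g10-0); `--supports stmt-BirchSwinnertonDyer-20368`
(helper, Theses-free). HONEST FRAMING: nothing here closes the crux or a registered stub; BSD is not proved by any of this; no summit
statement is proved by this seat. No definition, no named fact, no `sorry`. LEAD ASSIGN 2026-08-29T00:16:10Z (1), with the FINDING of this seat
(STATUS ~01:25Z): the tree's pinning / CM-scalar / (H1′) chain depends on `Finite 𝔖` itself, so the converse of (ShaFin) must DISPLAY the one local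
input it needs — (MW-v̄) «the `W*`-component of the Mordell–Weil Kummer line is not strict at `v̄`», a statement that FAILS exactly when `𝔖` contains
the whole Prüfer line `j_*⁻¹(res_⊤ range κ)` (and is implied by the hfin-free local brick (ET) named there).

WHAT. **`finite_restrictedSelmerBase_of_finite_sha_of_frame`**: the frame binders of `hcounts` (p678471) WITHOUT `Finite (restrictedSelmerBase …)`, then
`Finite (AddCommGroup.primaryComponent (W.baseChange K).sha 2) → (MW-v̄) → Finite (restrictedSelmerBase W* 2 vbar)`, (MW-v̄) in (F1)'s currency
`¬ (((range κ).map res_⊤).comap j_* ≤ ker (resOfLe W* (⊤ ⊓ decomp v̄ ≤ ⊤)))`. PROOF = part 2's `finite_restrictedSelmerBase_of_uniform_of_finite` with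
(U) := part 1's `exists_uniform_nsmul_mem_selmerGroup_of_apply_ne_zero` at the relaxed split place `v` (`λ` from `U_v ≃+ ℤ₂`, -w7's
`LocalPointsScalar.exists_finiteIndex_addEquiv_padicInt_of_finrank_eq_one`; `P_K` of infinite order; `#(𝓞_v/2^{k+1}) = 2^{k+1}`, this seat's
`natCard_quot_adicCompletionIntegers_two_pow_of_split`), the CM data `φ` (`exists_isogeny_apply_eq_cmEndo`), `e, e′` (`exists_eigenProjector`), and
(Q) := `finite_comap_kummer_inf_ker_of_not_le` (§1: the Prüfer line `{k • g_N}` of -w6 g3's `exists_comap_kummer_eq_zsmul_of_frame` meets `ker res_{v̄}`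
in `ℤ·g_D`, -w6's `inf_ker_eq_zmultiples`, the threshold `D` built from (MW-v̄) by `Nat.findGreatest`).
ALSO `not_comap_kummer_le_ker_of_finite` — the converse direction «`Finite 𝔖 ⟹` (MW-v̄)» — so that, given `Finite Ш(W_K)[2^∞]`, (MW-v̄) is
EQUIVALENT to the frame's `hfin`. presearch: Agboola 2007 Thm. 6.12 / Props. 6.10–6.11 (hypothesis «Ш(K)(𝔭*) finite» at `r = 1`); Coates 1983,
Perrin-Riou 1984 (odd `p`) → assembled here from tree theorems; no new fact. beyond-print theorem: no.

References: [Agboola2007] §6 Props. 6.10–6.12, Thm. 6.12; [GreenbergLNM1716] §2, §5; [MilneADT2006] I Thm. 4.10(b); [SilvermanAEC2009] VII.6.3, X.4.2(b);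
[Rubin1999] §2.
-/

noncomputable section

open scoped Classical

set_option linter.dupNamespace false
set_option autoImplicit false

open CategoryTheory Function Field NumberField IsDedekindDomain WeierstrassCurve
open Literature.NumberTheory.EllipticCurves Literature.NumberTheory.EllipticCurves.GreenbergSelmer
open Literature.NumberTheory.EllipticCurves.Agboola2007
open Literature.NumberTheory.EllipticCurves.ResKernel
open Literature.NumberTheory.GaloisRepresentations
open Literature.NumberTheory.GaloisCohomology
open scoped ContRepresentation
open Summit.BirchSwinnertonDyer.Rank1Residual.X11b
open Summit.BirchSwinnertonDyer.BirchSwinnertonDyer.Theorems.PrintCf2.RestrictedSelmerPair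
open Summit.BirchSwinnertonDyer.BirchSwinnertonDyer.Theorems.PrintCf2.AdditiveAtSeven
open Summit.BirchSwinnertonDyer.BirchSwinnertonDyer.Theorems.GoldfeldGoodTwists
open Summit.BirchSwinnertonDyer.BirchSwinnertonDyer.Theorems.PrintCf2.CMPrimes

namespace Summit.BirchSwinnertonDyer.BirchSwinnertonDyer.Theorems.PrintCf2.RelaxationLift

/-! ## §1. The Prüfer line meets a kernel in a finite group as soon as it is not contained in it -/

section Line

variable {A B : Type*} [AddCommGroup A] [AddCommGroup B]

/-- **A threshold from one non-vanishing**: for a `2`-tower `g` (`2 • g (N+1) = g N`, `2^N • g N = 0`) and a homomorphism `f` with `f (g N₀) ≠ 0`,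
there is `D` with `f (g N) = 0 ↔ N ≤ D` (the set of vanishing levels is downward closed — `g M = 2^{N−M} • g N` — contains `0` and misses `N₀`).
[folklore] -/
theorem exists_threshold_of_apply_ne_zero (g : ℕ → A) (hg : ∀ N, 2 • g (N + 1) = g N) (hg0 : ∀ N, 2 ^ N • g N = 0) (f : A →+ B) {N₀ : ℕ}
    (hN₀ : f (g N₀) ≠ 0) : ∃ D : ℕ, ∀ N, f (g N) = 0 ↔ N ≤ D := by
  have hdown : ∀ M N, M ≤ N → f (g N) = 0 → f (g M) = 0 := by
    intro M N hMN h
    obtain ⟨j, rfl⟩ := Nat.exists_eq_add_of_le hMN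
    rw [← pow_smul_tower g hg M j, map_nsmul, h, smul_zero]
  have h0 : f (g 0) = 0 := by
    have : g 0 = 0 := by rw [← hg0 0, pow_zero, one_smul]
    rw [this, map_zero]
  refine ⟨Nat.findGreatest (fun N ↦ f (g N) = 0) N₀, fun N ↦ ⟨fun h ↦ ?_, fun h ↦ ?_⟩⟩
  · have hlt : N ≤ N₀ := by
      by_contra hc
      exact hN₀ (hdown N₀ N (le_of_not_ge hc) h)
    exact Nat.le_findGreatest hlt h
  · exact hdown N _ h (Nat.findGreatest_spec (P := fun N ↦ f (g N) = 0) (Nat.zero_le N₀) h0)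

/-- **The part of the line killed by `f` is finite when the line is not killed by `f`**: for a `2`-tower `g`, a subgroup `Q` exhausted by and
containing the multiples of the `g N`, and `f` with `¬ (Q ≤ ker f)`: `Q ⊓ ker f = ℤ·g_D` is finite (-w6 g3's `inf_ker_eq_zmultiples`).
[folklore] -/
theorem finite_inf_ker_of_not_le (g : ℕ → A) (hg : ∀ N, 2 • g (N + 1) = g N) (hg0 : ∀ N, 2 ^ N • g N = 0)
    (Q : AddSubgroup A) (hQ : ∀ q ∈ Q, ∃ (N : ℕ) (k : ℤ), q = k • g N) (hgQ : ∀ N, g N ∈ Q)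
    (f : A →+ B) (hnot : ¬ (Q ≤ f.ker)) : Finite ↥(Q ⊓ f.ker) := by
  -- a level `N₀` with `f (g N₀) ≠ 0`
  obtain ⟨q, hq, hqf⟩ := Set.not_subset.mp hnot
  obtain ⟨N₁, k, rfl⟩ := hQ q hq
  have hN₁ : f (g N₁) ≠ 0 := fun h ↦ hqf (by rw [SetLike.mem_coe, AddMonoidHom.mem_ker, map_zsmul, h, zsmul_zero])
  obtain ⟨D, hD⟩ := exists_threshold_of_apply_ne_zero g hg hg0 f hN₁
  rw [inf_ker_eq_zmultiples Nat.prime_two g hg hg0 Q hQ hgQ f hD]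
  have hfin : IsOfFinAddOrder (g D) := isOfFinAddOrder_iff_nsmul_eq_zero.mpr ⟨2 ^ D, pow_pos two_pos D, hg0 D⟩
  exact Nat.finite_of_card_ne_zero (by rw [Nat.card_zmultiples]; exact (addOrderOf_pos_iff.mpr hfin).ne')

end Line

/-! ## §2. The frame -/

section Frame

variable {K : Type} [Field K] [NumberField K]

/-- **(Q) on the frame from (MW-v̄)**: the `W*`-components of the Mordell–Weil Kummer classes strict at `v̄`,
`j_*⁻¹(res_⊤ range κ) ⊓ ker res_{D_{v̄}}`, form a finite group as soon as the line `j_*⁻¹(res_⊤ range κ) = {k • e_* res_⊤ κ_N(P_K)}`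
(-w6 g3 `exists_comap_kummer_eq_zsmul_of_frame`, -w3 g9 (S) `resSubgroup_kummer_stable`) is not contained in that kernel. [cite: Agboola2007, §6]
[cite: Rubin1999, §2] -/
theorem finite_comap_kummer_inf_ker_of_not_le {d : ℤ} (hd0 : d ≠ 0) (W : WeierstrassCurve ℚ) [W.IsElliptic]
    (C : VariableChange ℚ) (hC : C • W = cm7.quadraticTwist (d : ℚ)) (hK : IsImaginaryQuadratic K) (vbar : HeightOneSpectrum (𝓞 K))
    (π : (W.baseChange K).endRing) (hrel : (π : AddMonoid.End (W.baseChange K).geomPoints) * π = π - 2) {r : ℤ_[2]} (hr : r * r = r - 2)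
    {P : W.toAffine.Point} (hP : ¬ IsOfFinAddOrder P)
    (hgen : ∀ R : W.toAffine.Point, ∃ (k : ℤ) (T : W.toAffine.Point), IsOfFinAddOrder T ∧ R = k • P + T)
    (hMW : ¬ (((((W.baseChange K).kummerMapPInfty 2 (W.baseChange K).zsmul_geomPoints_surjective_holds).range).map
        (resSubgroup ⊤ ((W.baseChange K).geomPrimaryTorsion 2))).comap
          (resH1Hom (ContinuousMonoidHom.id _) ((W.baseChange K).endEigenPrimaryTorsion 2 π r).subtype (fun _ _ ↦ rfl)) ≤
      (resOfLe ↥((W.baseChange K).endEigenPrimaryTorsion 2 π r) (@inf_le_left _ _ (⊤ : Subgroup (absoluteGaloisGroup K)) (decomp vbar))).ker)) :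
    Finite ↥(((((W.baseChange K).kummerMapPInfty 2 (W.baseChange K).zsmul_geomPoints_surjective_holds).range).map
        (resSubgroup ⊤ ((W.baseChange K).geomPrimaryTorsion 2))).comap
          (resH1Hom (ContinuousMonoidHom.id _) ((W.baseChange K).endEigenPrimaryTorsion 2 π r).subtype (fun _ _ ↦ rfl)) ⊓
      (resOfLe ↥((W.baseChange K).endEigenPrimaryTorsion 2 π r) (@inf_le_left _ _ (⊤ : Subgroup (absoluteGaloisGroup K)) (decomp vbar))).ker) := by
  haveI : Fact (Nat.Prime 2) := ⟨Nat.prime_two⟩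
  obtain ⟨hinf, hsup⟩ := endEigenPrimaryTorsion_compl_of_frame hd0 W C hC K π hrel hr
  have hunit : IsUnit (r - (1 - r)) := (two_dvd_or_two_dvd_one_sub_of_root hr).2
  obtain ⟨e, he₁, -, he₃, he⟩ := exists_eigenProjector (W.baseChange K) 2 π r (1 - r) hinf hsup
  obtain ⟨e', he'₁, he'₂, -, he'⟩ := exists_eigenProjector (W.baseChange K) 2 π (1 - r) r (by rw [inf_comm]; exact hinf)
    (by rw [sup_comm]; exact hsup)
  have hsum := coe_proj_add_coe_proj (W.baseChange K) 2 π r (1 - r) e e' he₃ he'₁ he'₂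
  -- the tower `g N = e_* res_⊤ κ_N(P_K)`
  set PK : (W.baseChange K).toAffine.Point := Affine.Point.map (W' := W.toAffine) (Algebra.ofId ℚ K) P
  set eStar : subgroupH1 (⊤ : Subgroup (absoluteGaloisGroup K)) ((W.baseChange K).geomPrimaryTorsion 2) →+
      subgroupH1 (⊤ : Subgroup (absoluteGaloisGroup K)) ↥((W.baseChange K).endEigenPrimaryTorsion 2 π r) :=
    resH1Hom (ContinuousMonoidHom.id (⊤ : Subgroup (absoluteGaloisGroup K))) e (fun σ x ↦ he σ x)
  set κN : ℕ → subgroupH1 (⊤ : Subgroup (absoluteGaloisGroup K)) ((W.baseChange K).geomPrimaryTorsion 2) := fun N ↦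
    resSubgroup ⊤ ((W.baseChange K).geomPrimaryTorsion 2)
      ((W.baseChange K).kummerMapLevel 2 (W.baseChange K).zsmul_geomPoints_surjective_holds N PK) with hκN
  set g : ℕ → subgroupH1 (⊤ : Subgroup (absoluteGaloisGroup K)) ↥((W.baseChange K).endEigenPrimaryTorsion 2 π r) :=
    fun N ↦ eStar (κN N) with hg
  set Q₀ := (((W.baseChange K).kummerMapPInfty 2 (W.baseChange K).zsmul_geomPoints_surjective_holds).range).map
    (resSubgroup ⊤ ((W.baseChange K).geomPrimaryTorsion 2)) with hQ₀
  have hκN_mem : ∀ N, κN N ∈ Q₀ := fun N ↦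
    ⟨_, ⟨PK ⊗ₜ prufGen 2 N, rfl⟩, by rw [(W.baseChange K).kummerMapPInfty_tmul_prufGen]⟩
  have hg_succ : ∀ N, 2 • g (N + 1) = g N := fun N ↦ by
    have hlev := (W.baseChange K).kummerMapLevel_level 2 (W.baseChange K).zsmul_geomPoints_surjective_holds N 1 (N + 1) rfl PK
    rw [pow_one] at hlev
    simp only [hg, hκN, ← map_nsmul, hlev]
  have hg_zero : ∀ N, 2 ^ N • g N = 0 := fun N ↦ by
    simp only [hg, hκN, ← map_nsmul]
    rw [(W.baseChange K).kummerMapLevel_nsmul_self 2 _ N PK, map_zero, map_zero]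
  have hQ : ∀ q ∈ Q₀.comap (resH1Hom (ContinuousMonoidHom.id _) ((W.baseChange K).endEigenPrimaryTorsion 2 π r).subtype (fun _ _ ↦ rfl)),
      ∃ (N : ℕ) (k : ℤ), q = k • g N := fun q hq ↦
    exists_comap_kummer_eq_zsmul_of_frame W K hK π hrel hunit e e' he₁ he hsum hP hgen hq
  have hgQ : ∀ N, g N ∈ Q₀.comap (resH1Hom (ContinuousMonoidHom.id _) ((W.baseChange K).endEigenPrimaryTorsion 2 π r).subtype
      (fun _ _ ↦ rfl)) := fun N ↦ by
    rw [AddSubgroup.mem_comap]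
    exact resSubgroup_kummer_stable (W.baseChange K) 2 π r (1 - r) hunit e e' he hsum _ (hκN_mem N)
  exact finite_inf_ker_of_not_le g hg_succ hg_zero _ hQ hgQ _ hMW

/-- **(BF) — `Finite Ш(W_K/K)[2^∞]` ∧ (MW-v̄) ⟹ `Finite 𝔖_{v̄}(K, W*)` ON EVERY S3c FRAME** (frame binders of `hcounts`, p678471, WITHOUT
`Finite (restrictedSelmerBase …)`). (MW-v̄): the `W*`-component of the Mordell–Weil Kummer line, `j_*⁻¹(res_⊤ range κ)`, is NOT contained in
`ker res_{D_{v̄}}` — the hfin-free form of «`π` acts on `E(K_v̄)/tors` as `r`»; were it to fail, `𝔖` would contain that Prüfer line. Assembly of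
parts 1–2: the uniform relaxation exponent at the relaxed split place `v` (`λ` from `U_v ≃+ ℤ₂`, `P_K` of infinite order, `#(𝓞_v/2^{k+1}) = 2^{k+1}`),
the CM isogeny `φ` realising `π` with its local points maps, the eigen-projectors, and (Q) from (MW-v̄) (`finite_comap_kummer_inf_ker_of_not_le`).
[cite: Agboola2007, §6 Props. 6.10–6.12, Thm. 6.12 (arXiv p0014–p0015)] [cite: GreenbergLNM1716, §2 p. 63, §5 proof of Prop. 5.8]
[cite: MilneADT2006, I Thm. 4.10(b)] [cite: SilvermanAEC2009, Prop. VII.6.3, Thm. X.4.2(b)] -/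
theorem finite_restrictedSelmerBase_of_finite_sha_of_frame :
    ∀ (d : ℤ), d ≠ 0 → Squarefree d → d % 4 ≠ 1 →
      ∀ (W : WeierstrassCurve ℚ) [W.IsElliptic] [W.IsGloballyMinimal] (C : WeierstrassCurve.VariableChange ℚ),
        C • W = cm7.quadraticTwist (d : ℚ) → W.analyticRank = 1 →
      ∀ (K : Type) [Field K] [NumberField K], IsImaginaryQuadratic K →
      ∀ (v vbar : HeightOneSpectrum (𝓞 K)),
        ((2 : ℕ) : 𝓞 K) ∈ v.asIdeal → ((2 : ℕ) : 𝓞 K) ∈ vbar.asIdeal → vbar ≠ v →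
      ∀ (π : (W.baseChange K).endRing), (π : AddMonoid.End (W.baseChange K).geomPoints) * π = π - 2 →
      ∀ (r : ℤ_[2]), r * r = r - 2 →
        (∀ τ ∈ GreenbergSelmer.inertia v, ∀ x : ↥((W.baseChange K).endEigenPrimaryTorsion 2 π r), τ • x = x ∨ τ • x = -x) →
      ∀ (P : W.toAffine.Point) (c₀ : ℕ) (ℓ : ℤ),
        ¬ IsOfFinAddOrder P →
        (∀ R : W.toAffine.Point, ∃ (k : ℤ) (T : W.toAffine.Point), IsOfFinAddOrder T ∧ R = k • P + T) →
        c₀ ≠ 0 → (W.baseChange ℚ_[2]).IsInReductionKernel (c₀ • W.toPadicPoint 2 P) →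
        ‖(W.baseChange ℚ_[2]).padicLogPoint (c₀ • W.toPadicPoint 2 P) / (c₀ : ℚ_[2])‖ = (2 : ℝ) ^ (-ℓ) →
      Finite (AddCommGroup.primaryComponent (W.baseChange K).sha 2) →
      ¬ (((((W.baseChange K).kummerMapPInfty 2 (W.baseChange K).zsmul_geomPoints_surjective_holds).range).map
          (resSubgroup ⊤ ((W.baseChange K).geomPrimaryTorsion 2))).comap
            (resH1Hom (ContinuousMonoidHom.id _) ((W.baseChange K).endEigenPrimaryTorsion 2 π r).subtype (fun _ _ ↦ rfl)) ≤
        (resOfLe ↥((W.baseChange K).endEigenPrimaryTorsion 2 π r) (@inf_le_left _ _ (⊤ : Subgroup (absoluteGaloisGroup K)) (decomp vbar))).ker) →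
      Finite (restrictedSelmerBase ↥((W.baseChange K).endEigenPrimaryTorsion 2 π r) 2 vbar) := by
  intro d hd0 _ _ W _ _ C hC _ K _ _ hK v vbar hv hvbar hne π hrel r hr _ P _ _ hP hgen _ _ _ hsha hMW
  haveI : Fact (Nat.Prime 2) := ⟨Nat.prime_two⟩
  haveI : IsTotallyComplex K := hK.2
  haveI : (W.baseChange K).IsElliptic := by rw [baseChange]; infer_instance
  haveI := hsha
  -- CM supplies
  have hπg : (π : AddMonoid.End (W.baseChange K).geomPoints) ∈ (W.baseChange K).geomEndRing := (W.baseChange K).endRing_le_geomEndRing π.2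
  have hπG : ∀ (g : absoluteGaloisGroup K) (Q : (W.baseChange K).geomPoints),
      (π : AddMonoid.End (W.baseChange K).geomPoints) (g • Q) = g • (π : AddMonoid.End (W.baseChange K).geomPoints) Q :=
    ((W.baseChange K).mem_equivariantSubring_iff _).mp (Subring.mem_inf.mp π.2).2
  obtain ⟨φ, hφ, -⟩ := exists_isogeny_apply_eq_cmEndo (W.baseChange K) hπg hπG hrel
  obtain ⟨hinf, hsup⟩ := endEigenPrimaryTorsion_compl_of_frame hd0 W C hC K π hrel hr
  have hunit : IsUnit (r - (1 - r)) := (two_dvd_or_two_dvd_one_sub_of_root hr).2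
  obtain ⟨e, he₁, -, he₃, he⟩ := exists_eigenProjector (W.baseChange K) 2 π r (1 - r) hinf hsup
  obtain ⟨e', he'₁, he'₂, -, he'⟩ := exists_eigenProjector (W.baseChange K) 2 π (1 - r) r (by rw [inf_comm]; exact hinf)
    (by rw [sup_comm]; exact hsup)
  have hsum := coe_proj_add_coe_proj (W.baseChange K) 2 π r (1 - r) e e' he₃ he'₁ he'₂
  have hfr : ∀ (k : ℕ) (N : ℤ) (x : (W.baseChange K).geomPrimaryTorsion 2), x ∈ (W.baseChange K).endEigenPrimaryTorsion 2 π r → 2 ^ k • x = 0 →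
      ((N : ℤ_[2]) - r) ∈ (Ideal.span {(2 : ℤ_[2]) ^ k} : Ideal ℤ_[2]) →
        φ.toAddMonoidHom (x : (W.baseChange K).geomPoints) = N • (x : (W.baseChange K).geomPoints) := fun k N x hx hk hN ↦ by
    rw [show φ.toAddMonoidHom (x : (W.baseChange K).geomPoints) = φ (x : (W.baseChange K).geomPoints) from rfl, hφ]
    exact (eigen_of_endRing (W.baseChange K) 2 π r).2 k N x hx hk hN
  have hfr' : ∀ (k : ℕ) (N : ℤ) (x : (W.baseChange K).geomPrimaryTorsion 2), x ∈ (W.baseChange K).endEigenPrimaryTorsion 2 π (1 - r) →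
      2 ^ k • x = 0 → ((N : ℤ_[2]) - (1 - r)) ∈ (Ideal.span {(2 : ℤ_[2]) ^ k} : Ideal ℤ_[2]) →
        φ.toAddMonoidHom (x : (W.baseChange K).geomPoints) = N • (x : (W.baseChange K).geomPoints) := fun k N x hx hk hN ↦ by
    rw [show φ.toAddMonoidHom (x : (W.baseChange K).geomPoints) = φ (x : (W.baseChange K).geomPoints) from rfl, hφ]
    exact (eigen_of_endRing (W.baseChange K) 2 π (1 - r)).2 k N x hx hk hN
  have hall : ∀ w : HeightOneSpectrum (𝓞 K), ((2 : ℕ) : 𝓞 K) ∈ w.asIdeal → w = v ∨ w = vbar :=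
    fun w hw ↦ eq_or_eq_of_two_mem K hK.1 hv hvbar hne hw
  -- (U): the uniform relaxation exponent at `v`
  have hU : ∃ N : ℕ, N ≠ 0 ∧ ∀ (k : ℕ) (c : galH1Torsion (W.baseChange K) ((2 ^ (k + 1) : ℕ) : ℤ)),
      c ∈ kummerOutside (W.baseChange K) (2 ^ (k + 1)) {Sum.inr v} → N • c ∈ selmerGroup (W.baseChange K) ((2 ^ (k + 1) : ℕ) : ℤ) := by
    letI : Algebra ℚ_[2] (v.adicCompletion K) := LocalField.adicCompletionPadicAlgebra v 2 hv
    have h1 : Module.finrank ℚ_[2] (v.adicCompletion K) = 1 := by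
      rw [Literature.NumberTheory.NumberFields.finrank_adicCompletionPadicAlgebra_eq 2 v hv]
      exact LocalPointsScalar.ramificationIdx_mul_inertiaDeg_eq_one_of_ne hK.1 hv hvbar hne
    haveI : FiniteDimensional ℚ_[2] (v.adicCompletion K) := Module.finite_of_finrank_pos (by rw [h1]; exact one_pos)
    haveI : CharZero (v.adicCompletion K) := charZero_adicCompletion v
    haveI : ((W.baseChange K).baseChange (v.adicCompletion K)).IsElliptic :=
      inferInstanceAs (((W.baseChange K).map (algebraMap K (v.adicCompletion K))).IsElliptic)
    obtain ⟨U, hUidx, ⟨eU⟩⟩ := LocalPointsScalar.exists_finiteIndex_addEquiv_padicInt_of_finrank_eq_one 2 h1 ((W.baseChange K).baseChange (v.adicCompletion K))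
    haveI := hUidx
    obtain ⟨lam, hlam⟩ := exists_addMonoidHom_padicInt_eq_zero_iff 2 U eU
    set PK : (W.baseChange K).toAffine.Point := Affine.Point.map (W' := W.toAffine) (Algebra.ofId ℚ K) P with hPK
    have hPK : ¬ IsOfFinAddOrder PK := not_isOfFinAddOrder_map_ofId W hP
    have hu0 : lam (Affine.Point.baseChange (W' := W.baseChange K) K (v.adicCompletion K) PK) ≠ 0 := by
      intro h0
      apply hPK
      have htor := (hlam _).mp h0
      exact (Affine.Point.map_injective (W' := W.baseChange K) (Algebra.ofId K (v.adicCompletion K))).isOfFinAddOrder_iff.mp htor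
    exact exists_uniform_nsmul_mem_selmerGroup_of_apply_ne_zero (W.baseChange K) v 2 lam PK hu0
      (fun k ↦ natCard_quot_adicCompletionIntegers_two_pow_of_split hK.1 hv hvbar hne (k + 1))
  -- (Q) from (MW-v̄)
  have hQ := finite_comap_kummer_inf_ker_of_not_le hd0 W C hC hK vbar π hrel hr hP hgen hMW
  exact finite_restrictedSelmerBase_of_uniform_of_finite (W.baseChange K) 2 π r (1 - r) φ.toAddMonoidHom φ.equivariant hfr hfr' hunit
    φ.hasLocalPointsMaps_toAddMonoidHom e e' he he' hsum he₁ hall hU hQ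

/-- **The converse: `Finite 𝔖_{v̄}(K, W*) ⟹` (MW-v̄)** on the frame (`hd0`, `C • W = cm7^{(d)}`, `K` imaginary quadratic, `π² = π − 2`, `r² = r − 2`,
`P ∈ W(ℚ)` of infinite order generating `W(ℚ)` up to torsion). If the `W*`-component of the Mordell–Weil Kummer line were strict at `v̄`, it would lie
INSIDE `𝔖_{v̄}(K, W*)` (`comap_kummer_le_restrictedSelmerBase_of_strict`), but it carries the tower `g_N = e_* res_⊤ κ_N(P_K)` of elements of order
`2^N` (`g_1 ≠ 0`: `w(πP − N₂P) ∉ 2 W(K) + tors`, -w6 g3's `MordellWeilCM.not_exists_piSub_eq_pow_smul_of_frame`). So, granted `Finite Ш(W_K)[2^∞]`,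
(MW-v̄) is EQUIVALENT to the frame's `Finite 𝔖`. [cite: Agboola2007, §6 Thm. 6.12] [cite: Rubin1999, §2] -/
theorem not_comap_kummer_le_ker_of_finite {d : ℤ} (hd0 : d ≠ 0) (W : WeierstrassCurve ℚ) [W.IsElliptic]
    (C : VariableChange ℚ) (hC : C • W = cm7.quadraticTwist (d : ℚ)) (hK : IsImaginaryQuadratic K) (vbar : HeightOneSpectrum (𝓞 K))
    (π : (W.baseChange K).endRing) (hrel : (π : AddMonoid.End (W.baseChange K).geomPoints) * π = π - 2) {r : ℤ_[2]} (hr : r * r = r - 2)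
    {P : W.toAffine.Point} (hP : ¬ IsOfFinAddOrder P)
    (hgen : ∀ R : W.toAffine.Point, ∃ (k : ℤ) (T : W.toAffine.Point), IsOfFinAddOrder T ∧ R = k • P + T)
    [hfin : Finite (restrictedSelmerBase ↥((W.baseChange K).endEigenPrimaryTorsion 2 π r) 2 vbar)] :
    ¬ (((((W.baseChange K).kummerMapPInfty 2 (W.baseChange K).zsmul_geomPoints_surjective_holds).range).map
        (resSubgroup ⊤ ((W.baseChange K).geomPrimaryTorsion 2))).comap
          (resH1Hom (ContinuousMonoidHom.id _) ((W.baseChange K).endEigenPrimaryTorsion 2 π r).subtype (fun _ _ ↦ rfl)) ≤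
      (resOfLe ↥((W.baseChange K).endEigenPrimaryTorsion 2 π r) (@inf_le_left _ _ (⊤ : Subgroup (absoluteGaloisGroup K)) (decomp vbar))).ker) := by
  intro hle
  haveI : Fact (Nat.Prime 2) := ⟨Nat.prime_two⟩
  obtain ⟨hinf, hsup⟩ := endEigenPrimaryTorsion_compl_of_frame hd0 W C hC K π hrel hr
  have hunit : IsUnit (r - (1 - r)) := (two_dvd_or_two_dvd_one_sub_of_root hr).2
  obtain ⟨e, he₁, -, he₃, he⟩ := exists_eigenProjector (W.baseChange K) 2 π r (1 - r) hinf hsup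
  obtain ⟨e', he'₁, he'₂, -, he'⟩ := exists_eigenProjector (W.baseChange K) 2 π (1 - r) r (by rw [inf_comm]; exact hinf)
    (by rw [sup_comm]; exact hsup)
  have hsum := coe_proj_add_coe_proj (W.baseChange K) 2 π r (1 - r) e e' he₃ he'₁ he'₂
  -- the line lies inside `𝔖`
  have hQ𝔖 := comap_kummer_le_restrictedSelmerBase_of_strict (W.baseChange K) 2 π r (1 - r) vbar hK hinf hsup hle
  -- the tower `g N = e_* res_⊤ κ_N(P_K)`
  set PK : (W.baseChange K).toAffine.Point := Affine.Point.map (W' := W.toAffine) (Algebra.ofId ℚ K) P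
  set eStar : subgroupH1 (⊤ : Subgroup (absoluteGaloisGroup K)) ((W.baseChange K).geomPrimaryTorsion 2) →+
      subgroupH1 (⊤ : Subgroup (absoluteGaloisGroup K)) ↥((W.baseChange K).endEigenPrimaryTorsion 2 π r) :=
    resH1Hom (ContinuousMonoidHom.id (⊤ : Subgroup (absoluteGaloisGroup K))) e (fun σ x ↦ he σ x)
  set κN : ℕ → subgroupH1 (⊤ : Subgroup (absoluteGaloisGroup K)) ((W.baseChange K).geomPrimaryTorsion 2) := fun N ↦
    resSubgroup ⊤ ((W.baseChange K).geomPrimaryTorsion 2)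
      ((W.baseChange K).kummerMapLevel 2 (W.baseChange K).zsmul_geomPoints_surjective_holds N PK) with hκN
  set g : ℕ → subgroupH1 (⊤ : Subgroup (absoluteGaloisGroup K)) ↥((W.baseChange K).endEigenPrimaryTorsion 2 π r) :=
    fun N ↦ eStar (κN N) with hg
  set Q₀ := (((W.baseChange K).kummerMapPInfty 2 (W.baseChange K).zsmul_geomPoints_surjective_holds).range).map
    (resSubgroup ⊤ ((W.baseChange K).geomPrimaryTorsion 2)) with hQ₀
  have hκN_mem : ∀ N, κN N ∈ Q₀ := fun N ↦
    ⟨_, ⟨PK ⊗ₜ prufGen 2 N, rfl⟩, by rw [(W.baseChange K).kummerMapPInfty_tmul_prufGen]⟩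
  have hg_succ : ∀ N, 2 • g (N + 1) = g N := fun N ↦ by
    have hlev := (W.baseChange K).kummerMapLevel_level 2 (W.baseChange K).zsmul_geomPoints_surjective_holds N 1 (N + 1) rfl PK
    rw [pow_one] at hlev
    simp only [hg, hκN, ← map_nsmul, hlev]
  have hg_zero : ∀ N, 2 ^ N • g N = 0 := fun N ↦ by
    simp only [hg, hκN, ← map_nsmul]
    rw [(W.baseChange K).kummerMapLevel_nsmul_self 2 _ N PK, map_zero, map_zero]
  -- `g 1 ≠ 0` (as in -w6 g3's (F1))
  have hg_one : g 1 ≠ 0 := by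
    intro h0
    obtain ⟨N₁, N₂, w, hN₁, hN₂, hw⟩ := exists_proj_levelData (p := 2) (r := r) (r' := 1 - r) hunit 1
    obtain ⟨P₁, hP₁⟩ := exists_toGeomPoints_eq_endRing_apply (W.baseChange K) π PK
    have hce := congrArg (fun f ↦ f ((W.baseChange K).kummerMapLevel 2 (W.baseChange K).zsmul_geomPoints_surjective_holds 1 PK))
      (resH1Hom_comp_resSubgroup (ContinuousMonoidHom.id (absoluteGaloisGroup K)) e (fun σ x ↦ he σ x) ⊤ ⊤
        (ContinuousMonoidHom.id (⊤ : Subgroup (absoluteGaloisGroup K))) (fun _ ↦ rfl) (fun σ x ↦ he σ x))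
    have hcι := congrArg (fun f ↦ f (resH1Hom (ContinuousMonoidHom.id (absoluteGaloisGroup K)) e (fun σ x ↦ he σ x)
        ((W.baseChange K).kummerMapLevel 2 (W.baseChange K).zsmul_geomPoints_surjective_holds 1 PK)))
      (resH1Hom_comp_resSubgroup (ContinuousMonoidHom.id (absoluteGaloisGroup K)) ((W.baseChange K).endEigenPrimaryTorsion 2 π r).subtype
        (fun _ _ ↦ rfl) ⊤ ⊤ (ContinuousMonoidHom.id (⊤ : Subgroup (absoluteGaloisGroup K))) (fun _ ↦ rfl) (fun _ _ ↦ rfl))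
    simp only [AddMonoidHom.comp_apply] at hce hcι
    have hκ' : resSubgroup ⊤ ((W.baseChange K).geomPrimaryTorsion 2)
        ((W.baseChange K).kummerMapLevel 2 (W.baseChange K).zsmul_geomPoints_surjective_holds 1 (w • (P₁ - N₂ • PK))) = 0 := by
      rw [← resH1Hom_subtype_proj_kummerMapLevel (W.baseChange K) 2 π r (1 - r) e e' he hsum hN₁ hN₂ hw PK P₁ hP₁, ← hcι, ← hce]
      change resH1Hom (ContinuousMonoidHom.id (⊤ : Subgroup (absoluteGaloisGroup K)))
          ((W.baseChange K).endEigenPrimaryTorsion 2 π r).subtype (fun _ _ ↦ rfl) (g 1) = 0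
      rw [h0, map_zero]
    have hκ0 : (W.baseChange K).kummerMapLevel 2 (W.baseChange K).zsmul_geomPoints_surjective_holds 1 (w • (P₁ - N₂ • PK)) = 0 :=
      resSubgroup_injective_of_forall_mem ⊤ _ (fun σ ↦ Subgroup.mem_top σ) (by rw [hκ', map_zero])
    obtain ⟨m, P₀, hm⟩ := (W.baseChange K).exists_of_kummerMapLevel_eq_zero 2 _ 1 _ hκ0
    obtain ⟨u, hu⟩ := odd_of_levelData one_ne_zero hw
    refine MordellWeilCM.not_exists_piSub_eq_pow_smul_of_frame W K hK π hrel hP hgen hP₁ N₂ (N := 1) le_rfl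
      ⟨P₀ - u • (P₁ - N₂ • PK), w • (P₁ - N₂ • PK) - 2 • P₀, ?_, ?_⟩
    · refine isOfFinAddOrder_iff_nsmul_eq_zero.mpr ⟨2 ^ m, pow_pos two_pos m, ?_⟩
      rw [smul_sub, hm, pow_add, pow_one, mul_smul, smul_comm (2 ^ m) 2 P₀, sub_self]
    · rw [hu]
      module
  -- the `g N ∈ 𝔖` have orders `2^N`, unbounded in a finite group: contradiction
  have hgQ : ∀ N, g N ∈ Q₀.comap (resH1Hom (ContinuousMonoidHom.id _) ((W.baseChange K).endEigenPrimaryTorsion 2 π r).subtype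
      (fun _ _ ↦ rfl)) := fun N ↦ by
    rw [AddSubgroup.mem_comap]
    exact resSubgroup_kummer_stable (W.baseChange K) 2 π r (1 - r) hunit e e' he hsum _ (hκN_mem N)
  have hord : ∀ N, addOrderOf (g N) = 2 ^ N := addOrderOf_tower g hg_succ hg_zero hg_one
  set n := Nat.card (restrictedSelmerBase ↥((W.baseChange K).endEigenPrimaryTorsion 2 π r) 2 vbar) with hn
  have hmem : g n ∈ restrictedSelmerBase ↥((W.baseChange K).endEigenPrimaryTorsion 2 π r) 2 vbar := hQ𝔖 (hgQ n)
  have hdvd : addOrderOf (⟨g n, hmem⟩ : restrictedSelmerBase ↥((W.baseChange K).endEigenPrimaryTorsion 2 π r) 2 vbar) ∣ n :=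
    addOrderOf_dvd_natCard _
  rw [AddSubgroup.addOrderOf_mk, hord] at hdvd
  have hle' : 2 ^ n ≤ n := Nat.le_of_dvd Nat.card_pos hdvd
  exact absurd hle' (not_le.mpr n.lt_two_pow_self)

end Frame

end Summit.BirchSwinnertonDyer.BirchSwinnertonDyer.Theorems.PrintCf2.RelaxationLift

end
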